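import Summits.Ventures.PercRepro.S1ChainCoNullCells

/-!
# PercRepro — SKEW UNIONS: THE 3-LAYER TRIANGLES OF A CHAIN SPAN A DIRECT SUM OF LINES (p2, gen 24; SUBCLAIM-S1 §6.9 (vi))

Two parts `S`, `T` of a matroid are SKEW when `r(S ∪ T) = r(S) + r(T)`. Then `r(A ∪ B) = r(A) + r(B)` for every
`A ⊆ S`, `B ⊆ T` (two submodularities), so a circuit inside `S ∪ T` lies inside `S` or inside `T`: its traces are
proper subsets, hence independent, and their ranks would add up to `|C| > r(C)`. A family of triangles whose union
has rank `2·|𝒯|` (the 3-layer triangles of an exact chain — each skew to the union of its predecessors) is therefore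
a direct sum of lines: EVERY circuit inside the union is one of the triangles, and in particular no four- or
five-circuit lies inside it. This is the first step of the joint cap of row 10 (S1 v59 §6.9 (vi)): at the open lines
of `(10, 7)` five skew triangles span the core and every four- or five-circuit passes through one of the two
remaining points.

* `eRk_union_eq_of_skew` — the skewness descends to subsets;
* `subset_or_subset_of_isCircuit_of_skew` — a circuit in a skew union lies on one side;
* `eRk_biUnion_triangles_le` — the union of `j` triangles has rank `≤ 2j`; `skew_of_insert` — the induction step;
* `eRk_eq_sum_inter_of_skew_union`, `eRk_inter_triangle_eq` — THE DIRECT-SUM RANK FORMULA `r(A) = Σ_T min(|A ∩ T|, 2)`;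
* **`mem_of_isCircuit_subset_skew_union`** — in a skew union of triangles every circuit is one of the triangles;
* `mem_closure_inter_of_modular` — the modular-pair closure lemma (`y ∈ cl A ∩ cl B ⇒ y ∈ cl (A ∩ B)` for a modular pair),
  the tool of the principal-extension count of §6.9 (vi);
* `ncard_circuits_subset_skew_union_eq_zero` — no circuit of size `≠ 3` inside a skew union of triangles.
Axioms: standard.
-/

open scoped Matroid

namespace PercRepro

namespace S1

open Set

variable {α : Type}

/-- The rank of a finite-matroid subset is a natural number. -/
theorem eRk_ne_top_of_subset (M : Matroid α) [M.Finite] {X : Set α} (hX : X ⊆ M.E) : M.eRk X ≠ ⊤ :=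
  ((M.eRk_le_encard X).trans_lt (M.ground_finite.subset hX).encard_lt_top).ne

/-- **SKEWNESS DESCENDS TO SUBSETS**: if `r(S ∪ T) = r(S) + r(T)` then `r(A ∪ B) = r(A) + r(B)` for all `A ⊆ S`,
`B ⊆ T`. -/
theorem eRk_union_eq_of_skew (M : Matroid α) [M.Finite] {S T : Set α} (hS : S ⊆ M.E) (hT : T ⊆ M.E)
    (hST : M.eRk (S ∪ T) = M.eRk S + M.eRk T) {A B : Set α} (hA : A ⊆ S) (hB : B ⊆ T) :
    M.eRk (A ∪ B) = M.eRk A + M.eRk B := by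
  have hAE : A ⊆ M.E := hA.trans hS
  have hBE : B ⊆ M.E := hB.trans hT
  -- step 1: `r(A ∪ T) = r(A) + r(T)`
  have h1 : M.eRk (A ∪ T) = M.eRk A + M.eRk T := by
    have hsub := M.eRk_inter_add_eRk_union_le (A ∪ T) S
    have e1 : (A ∪ T) ∪ S = S ∪ T := by
      ext x; simp only [Set.mem_union]; constructor
      · rintro ((h | h) | h)
        · exact Or.inl (hA h)
        · exact Or.inr h
        · exact Or.inl h
      · rintro (h | h)
        · exact Or.inr h
        · exact Or.inl (Or.inr h)
    have hmono : M.eRk A ≤ M.eRk ((A ∪ T) ∩ S) :=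
      M.eRk_mono (Set.subset_inter Set.subset_union_left hA)
    have hle : M.eRk (A ∪ T) ≤ M.eRk A + M.eRk T := M.eRk_union_le_eRk_add_eRk A T
    rw [e1, hST] at hsub
    obtain ⟨a, ha⟩ := ENat.ne_top_iff_exists.1 (eRk_ne_top_of_subset M hAE)
    obtain ⟨s, hs⟩ := ENat.ne_top_iff_exists.1 (eRk_ne_top_of_subset M hS)
    obtain ⟨t, ht⟩ := ENat.ne_top_iff_exists.1 (eRk_ne_top_of_subset M hT)
    obtain ⟨u, hu⟩ := ENat.ne_top_iff_exists.1 (eRk_ne_top_of_subset M (Set.union_subset hAE hT))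
    obtain ⟨i, hi⟩ := ENat.ne_top_iff_exists.1
      (eRk_ne_top_of_subset M (X := (A ∪ T) ∩ S) (Set.inter_subset_right.trans hS))
    rw [← hi, ← hs, ← ht, ← hu] at hsub
    rw [← ha, ← hi] at hmono
    rw [← hu, ← ha, ← ht] at hle
    have hsub' : i + (s + t) ≤ u + s := by exact_mod_cast hsub
    have hmono' : a ≤ i := by exact_mod_cast hmono
    have hle' : u ≤ a + t := by exact_mod_cast hle
    have : u = a + t := by omega
    rw [← hu, ← ha, ← ht, this]; push_cast; rfl
  -- step 2: `r(A ∪ B) = r(A) + r(B)`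
  have hsub := M.eRk_inter_add_eRk_union_le (A ∪ B) T
  have e2 : (A ∪ B) ∪ T = A ∪ T := by
    ext x; simp only [Set.mem_union]; constructor
    · rintro ((h | h) | h)
      · exact Or.inl h
      · exact Or.inr (hB h)
      · exact Or.inr h
    · rintro (h | h)
      · exact Or.inl (Or.inl h)
      · exact Or.inr h
  have hmono : M.eRk B ≤ M.eRk ((A ∪ B) ∩ T) :=
    M.eRk_mono (Set.subset_inter Set.subset_union_right hB)
  have hle : M.eRk (A ∪ B) ≤ M.eRk A + M.eRk B := M.eRk_union_le_eRk_add_eRk A B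
  rw [e2, h1] at hsub
  obtain ⟨a, ha⟩ := ENat.ne_top_iff_exists.1 (eRk_ne_top_of_subset M hAE)
  obtain ⟨b, hb⟩ := ENat.ne_top_iff_exists.1 (eRk_ne_top_of_subset M hBE)
  obtain ⟨t, ht⟩ := ENat.ne_top_iff_exists.1 (eRk_ne_top_of_subset M hT)
  obtain ⟨u, hu⟩ := ENat.ne_top_iff_exists.1 (eRk_ne_top_of_subset M (Set.union_subset hAE hBE))
  obtain ⟨i, hi⟩ := ENat.ne_top_iff_exists.1
    (eRk_ne_top_of_subset M (X := (A ∪ B) ∩ T) (Set.inter_subset_right.trans hT))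
  rw [← hi, ← ha, ← ht, ← hu] at hsub
  rw [← hb, ← hi] at hmono
  rw [← hu, ← ha, ← hb] at hle
  have hsub' : i + (a + t) ≤ u + t := by exact_mod_cast hsub
  have hmono' : b ≤ i := by exact_mod_cast hmono
  have hle' : u ≤ a + b := by exact_mod_cast hle
  have : u = a + b := by omega
  rw [← hu, ← ha, ← hb, this]; push_cast; rfl

/-- **A CIRCUIT IN A SKEW UNION LIES ON ONE SIDE**: if `r(S ∪ T) = r(S) + r(T)` and the circuit `C ⊆ S ∪ T`, then
`C ⊆ S` or `C ⊆ T` (otherwise its two traces are proper, independent, and their ranks add up to `≥ |C| > r(C)`). -/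
theorem subset_or_subset_of_isCircuit_of_skew (M : Matroid α) [M.Finite] {S T : Set α} (hS : S ⊆ M.E)
    (hT : T ⊆ M.E) (hST : M.eRk (S ∪ T) = M.eRk S + M.eRk T) {C : Set α} (hC : M.IsCircuit C)
    (hCST : C ⊆ S ∪ T) : C ⊆ S ∨ C ⊆ T := by
  by_contra hcon
  push Not at hcon
  obtain ⟨hCS, hCT⟩ := hcon
  have hCE : C ⊆ M.E := hC.subset_ground
  have hCfin : C.Finite := M.ground_finite.subset hCE
  set A := C ∩ S with hA
  set B := C ∩ T with hB
  have hAC : A ⊂ C := ⟨Set.inter_subset_left, fun h => hCS (fun x hx => (h hx).2)⟩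
  have hBC : B ⊂ C := ⟨Set.inter_subset_left, fun h => hCT (fun x hx => (h hx).2)⟩
  have hAB : A ∪ B = C := by
    ext x; simp only [hA, hB, Set.mem_union, Set.mem_inter_iff]; constructor
    · rintro (⟨h, _⟩ | ⟨h, _⟩) <;> exact h
    · intro hx
      rcases hCST hx with h | h
      · exact Or.inl ⟨hx, h⟩
      · exact Or.inr ⟨hx, h⟩
  have hrA : M.eRk A = (A.ncard : ℕ∞) := by
    rw [(hC.ssubset_indep hAC).eRk_eq_encard, (hCfin.subset Set.inter_subset_left).cast_ncard_eq]
  have hrB : M.eRk B = (B.ncard : ℕ∞) := by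
    rw [(hC.ssubset_indep hBC).eRk_eq_encard, (hCfin.subset Set.inter_subset_left).cast_ncard_eq]
  have hrC := hC.eRk_add_one_eq
  rw [← hCfin.cast_ncard_eq] at hrC
  have hskew := eRk_union_eq_of_skew M hS hT hST (A := A) (B := B) Set.inter_subset_right Set.inter_subset_right
  rw [hAB, hrA, hrB] at hskew
  have hcard : C.ncard ≤ A.ncard + B.ncard := by
    rw [← hAB]
    exact Set.ncard_union_le A B
  obtain ⟨c, hc⟩ := ENat.ne_top_iff_exists.1 (eRk_ne_top_of_subset M hCE)
  rw [← hc] at hrC hskew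
  have h1 : c + 1 = C.ncard := by exact_mod_cast hrC
  have h2 : c = A.ncard + B.ncard := by exact_mod_cast hskew
  omega

/-- The rank of a triangle is `2`. -/
theorem eRk_eq_two_of_triangle (M : Matroid α) [M.Finite] {T : Set α} (hT : M.IsCircuit T ∧ T.ncard = 3) :
    M.eRk T = 2 := by
  have hTfin : T.Finite := M.ground_finite.subset hT.1.subset_ground
  have h := hT.1.eRk_add_one_eq
  rw [← hTfin.cast_ncard_eq, hT.2] at h
  obtain ⟨r, hr⟩ := ENat.ne_top_iff_exists.1 (eRk_ne_top_of_subset M hT.1.subset_ground)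
  rw [← hr] at h ⊢
  have h' : r + 1 = 3 := by exact_mod_cast h
  have : r = 2 := by omega
  rw [this]; rfl

/-- The union of `j` triangles has rank `≤ 2j`. -/
theorem eRk_biUnion_triangles_le (M : Matroid α) [M.Finite] (𝒯 : Finset (Set α))
    (h𝒯 : ∀ C ∈ 𝒯, M.IsCircuit C ∧ C.ncard = 3) : M.eRk (⋃ C ∈ 𝒯, C) ≤ 2 * 𝒯.card := by
  classical
  induction 𝒯 using Finset.induction_on with
  | empty => simp
  | insert T 𝒯' hT ih =>
    rw [Finset.set_biUnion_insert, Finset.card_insert_of_notMem hT]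
    have ih' := ih (fun C hC => h𝒯 C (Finset.mem_insert_of_mem hC))
    have hT2 := eRk_eq_two_of_triangle M (h𝒯 T (Finset.mem_insert_self T 𝒯'))
    calc M.eRk (T ∪ ⋃ C ∈ 𝒯', C) ≤ M.eRk T + M.eRk (⋃ C ∈ 𝒯', C) := M.eRk_union_le_eRk_add_eRk _ _
      _ ≤ 2 + 2 * 𝒯'.card := by rw [hT2]; exact add_le_add le_rfl ih'
      _ = 2 * (𝒯'.card + 1) := by ring

/-- In a skew family `insert T 𝒯'` of triangles (rank `2(|𝒯'| + 1)`), the union of `𝒯'` has rank exactly `2|𝒯'|`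
and `T` is skew to it. -/
theorem skew_of_insert (M : Matroid α) [M.Finite] (𝒯' : Finset (Set α)) {T : Set α}
    (h𝒯' : ∀ C ∈ 𝒯', M.IsCircuit C ∧ C.ncard = 3) (hTtri : M.IsCircuit T ∧ T.ncard = 3)
    (hskew : M.eRk (T ∪ ⋃ C ∈ 𝒯', C) = 2 * ((𝒯'.card + 1 : ℕ) : ℕ∞)) :
    M.eRk (⋃ C ∈ 𝒯', C) = 2 * 𝒯'.card ∧ M.eRk (T ∪ ⋃ C ∈ 𝒯', C) = M.eRk T + M.eRk (⋃ C ∈ 𝒯', C) := by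
  have hT2 := eRk_eq_two_of_triangle M hTtri
  have hUle := eRk_biUnion_triangles_le M 𝒯' h𝒯'
  have hUE : (⋃ C ∈ 𝒯', C) ⊆ M.E := by
    intro x hx
    rw [Set.mem_iUnion₂] at hx
    obtain ⟨C', hC', hx'⟩ := hx
    exact (h𝒯' C' hC').1.subset_ground hx'
  have hle := M.eRk_union_le_eRk_add_eRk T (⋃ C ∈ 𝒯', C)
  obtain ⟨u, hu⟩ := ENat.ne_top_iff_exists.1 (eRk_ne_top_of_subset M hUE)
  rw [← hu] at hUle hle
  rw [hT2, hskew] at hle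
  have hUle' : u ≤ 2 * 𝒯'.card := by exact_mod_cast hUle
  have hle' : 2 * (𝒯'.card + 1) ≤ 2 + u := by exact_mod_cast hle
  have hu2 : u = 2 * 𝒯'.card := by omega
  refine ⟨by rw [← hu, hu2]; push_cast; ring, ?_⟩
  rw [hskew, hT2, ← hu, hu2]; push_cast; ring

/-- The ground set of a family of triangles. -/
theorem biUnion_subset_ground (M : Matroid α) (𝒯 : Finset (Set α))
    (h𝒯 : ∀ C ∈ 𝒯, M.IsCircuit C ∧ C.ncard = 3) : (⋃ C ∈ 𝒯, C) ⊆ M.E := by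
  intro x hx
  rw [Set.mem_iUnion₂] at hx
  obtain ⟨C', hC', hx'⟩ := hx
  exact (h𝒯 C' hC').1.subset_ground hx'

/-- **THE DIRECT-SUM RANK FORMULA**: in a skew union of triangles, `r(A) = Σ_{T ∈ 𝒯} r(A ∩ T)` for every `A ⊆ ⋃𝒯`. -/
theorem eRk_eq_sum_inter_of_skew_union (M : Matroid α) [M.Finite] (𝒯 : Finset (Set α))
    (h𝒯 : ∀ C ∈ 𝒯, M.IsCircuit C ∧ C.ncard = 3) (hskew : M.eRk (⋃ C ∈ 𝒯, C) = 2 * 𝒯.card)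
    {A : Set α} (hA : A ⊆ ⋃ C ∈ 𝒯, C) : M.eRk A = ∑ C ∈ 𝒯, M.eRk (A ∩ C) := by
  classical
  induction 𝒯 using Finset.induction_on generalizing A with
  | empty =>
    simp only [Finset.notMem_empty, Set.iUnion_of_empty, Set.iUnion_empty, Set.subset_empty_iff] at hA
    rw [hA, Finset.sum_empty, Matroid.eRk_empty]
  | insert T 𝒯' hT ih =>
    rw [Finset.set_biUnion_insert] at hskew hA
    rw [Finset.card_insert_of_notMem hT] at hskew
    have h𝒯' : ∀ C ∈ 𝒯', M.IsCircuit C ∧ C.ncard = 3 := fun C hC => h𝒯 C (Finset.mem_insert_of_mem hC)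
    have hTtri := h𝒯 T (Finset.mem_insert_self T 𝒯')
    obtain ⟨hU, hsk⟩ := skew_of_insert M 𝒯' h𝒯' hTtri hskew
    have hTE : T ⊆ M.E := hTtri.1.subset_ground
    have hUE := biUnion_subset_ground M 𝒯' h𝒯'
    have hsplit : A = (A ∩ T) ∪ (A ∩ ⋃ C ∈ 𝒯', C) := by
      ext x; simp only [Set.mem_union, Set.mem_inter_iff]; constructor
      · intro hx
        rcases hA hx with h | h
        · exact Or.inl ⟨hx, h⟩
        · exact Or.inr ⟨hx, h⟩
      · rintro (⟨h, _⟩ | ⟨h, _⟩) <;> exact h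
    rw [Finset.sum_insert hT]
    have hsk' := eRk_union_eq_of_skew M hTE hUE hsk (A := A ∩ T) (B := A ∩ ⋃ C ∈ 𝒯', C)
      Set.inter_subset_right Set.inter_subset_right
    rw [← hsplit] at hsk'
    rw [hsk']
    congr 1
    have := ih h𝒯' hU (A := A ∩ ⋃ C ∈ 𝒯', C) Set.inter_subset_right
    rw [this]
    refine Finset.sum_congr rfl (fun C hC => ?_)
    congr 1
    ext x; simp only [Set.mem_inter_iff, Set.mem_iUnion, exists_prop]
    constructor
    · rintro ⟨⟨hxA, -⟩, hxC⟩; exact ⟨hxA, hxC⟩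
    · rintro ⟨hxA, hxC⟩; exact ⟨⟨hxA, C, hC, hxC⟩, hxC⟩

/-- The rank of the trace of a set on a triangle is `min(|A ∩ T|, 2)`. -/
theorem eRk_inter_triangle_eq (M : Matroid α) [M.Finite] {T A : Set α} (hT : M.IsCircuit T ∧ T.ncard = 3) :
    M.eRk (A ∩ T) = ((min (A ∩ T).ncard 2 : ℕ) : ℕ∞) := by
  have hTfin : T.Finite := M.ground_finite.subset hT.1.subset_ground
  have hIfin : (A ∩ T).Finite := hTfin.subset Set.inter_subset_right
  by_cases h : A ∩ T = T
  · rw [h, eRk_eq_two_of_triangle M hT, hT.2]; rfl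
  · have hss : A ∩ T ⊂ T := ⟨Set.inter_subset_right, fun h' => h (Set.Subset.antisymm Set.inter_subset_right h')⟩
    have hlt : (A ∩ T).ncard < T.ncard := Set.ncard_lt_ncard hss hTfin
    rw [hT.2] at hlt
    rw [(hT.1.ssubset_indep hss).eRk_eq_encard, ← hIfin.cast_ncard_eq, min_eq_left (by omega)]

/-- **EVERY CIRCUIT INSIDE A SKEW UNION OF TRIANGLES IS ONE OF THE TRIANGLES**: for a family `𝒯` of triangles with
`r(⋃𝒯) = 2·|𝒯|`, a circuit `C ⊆ ⋃𝒯` belongs to `𝒯`. (The family is a direct sum of lines: each member is skew to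
the union of the others.) -/
theorem mem_of_isCircuit_subset_skew_union (M : Matroid α) [M.Finite] (𝒯 : Finset (Set α))
    (h𝒯 : ∀ C ∈ 𝒯, M.IsCircuit C ∧ C.ncard = 3) (hskew : M.eRk (⋃ C ∈ 𝒯, C) = 2 * 𝒯.card)
    {C : Set α} (hC : M.IsCircuit C) (hCsub : C ⊆ ⋃ C' ∈ 𝒯, C') : C ∈ 𝒯 := by
  classical
  induction 𝒯 using Finset.induction_on with
  | empty =>
    simp only [Finset.notMem_empty, Set.iUnion_of_empty, Set.iUnion_empty, Set.subset_empty_iff] at hCsub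
    exact absurd hCsub hC.nonempty.ne_empty
  | insert T 𝒯' hT ih =>
    rw [Finset.set_biUnion_insert] at hskew hCsub
    rw [Finset.card_insert_of_notMem hT] at hskew
    have h𝒯' : ∀ C ∈ 𝒯', M.IsCircuit C ∧ C.ncard = 3 := fun C hC => h𝒯 C (Finset.mem_insert_of_mem hC)
    have hTtri := h𝒯 T (Finset.mem_insert_self T 𝒯')
    obtain ⟨hU, hsk⟩ := skew_of_insert M 𝒯' h𝒯' hTtri hskew
    have hTE : T ⊆ M.E := hTtri.1.subset_ground
    have hUE := biUnion_subset_ground M 𝒯' h𝒯'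
    rcases subset_or_subset_of_isCircuit_of_skew M hTE hUE hsk hC hCsub with h | h
    · rw [hC.eq_of_subset_isCircuit hTtri.1 h]
      exact Finset.mem_insert_self T 𝒯'
    · exact Finset.mem_insert_of_mem (ih h𝒯' hU h)

/-- **THE MODULAR-PAIR CLOSURE LEMMA**: if `r(A ∪ B) + r(A ∩ B) = r(A) + r(B)` and `y` lies in the closures of both
`A` and `B`, then `y ∈ cl(A ∩ B)` (the flats whose closure contains `y` form a modular cut). -/
theorem mem_closure_inter_of_modular (M : Matroid α) [M.Finite] {A B : Set α} (hA : A ⊆ M.E) (hB : B ⊆ M.E)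
    (hmod : M.eRk (A ∪ B) + M.eRk (A ∩ B) = M.eRk A + M.eRk B) {y : α} (hy : y ∈ M.E)
    (hyA : y ∈ M.closure A) (hyB : y ∈ M.closure B) : y ∈ M.closure (A ∩ B) := by
  by_contra hcon
  have h1 : M.eRk (insert y (A ∩ B)) = M.eRk (A ∩ B) + 1 := M.eRk_insert_eq_add_one ⟨hy, hcon⟩
  have hrA : M.eRk (insert y A) = M.eRk A := by
    rw [← M.eRk_closure_eq (insert y A), M.closure_insert_eq_of_mem_closure hyA, M.eRk_closure_eq]
  have hrB : M.eRk (insert y B) = M.eRk B := by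
    rw [← M.eRk_closure_eq (insert y B), M.closure_insert_eq_of_mem_closure hyB, M.eRk_closure_eq]
  have hsub := M.eRk_inter_add_eRk_union_le (insert y A) (insert y B)
  rw [← Set.insert_inter_distrib, ← Set.insert_union_distrib, hrA, hrB, h1] at hsub
  have hmono : M.eRk (A ∪ B) ≤ M.eRk (insert y (A ∪ B)) := M.eRk_mono (Set.subset_insert _ _)
  obtain ⟨u, hu⟩ := ENat.ne_top_iff_exists.1 (eRk_ne_top_of_subset M (Set.union_subset hA hB))
  obtain ⟨i, hi⟩ := ENat.ne_top_iff_exists.1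
    (eRk_ne_top_of_subset M (X := A ∩ B) (Set.inter_subset_left.trans hA))
  obtain ⟨a, ha⟩ := ENat.ne_top_iff_exists.1 (eRk_ne_top_of_subset M hA)
  obtain ⟨b, hb⟩ := ENat.ne_top_iff_exists.1 (eRk_ne_top_of_subset M hB)
  obtain ⟨v, hv⟩ := ENat.ne_top_iff_exists.1
    (eRk_ne_top_of_subset M (X := insert y (A ∪ B)) (Set.insert_subset hy (Set.union_subset hA hB)))
  rw [← hi, ← ha, ← hb, ← hv] at hsub
  rw [← hu, ← hv] at hmono
  rw [← hu, ← hi, ← ha, ← hb] at hmod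
  have hsub' : i + 1 + v ≤ a + b := by exact_mod_cast hsub
  have hmono' : u ≤ v := by exact_mod_cast hmono
  have hmod' : u + i = a + b := by exact_mod_cast hmod
  omega

/-- **NO CIRCUIT OF SIZE `≠ 3` INSIDE A SKEW UNION OF TRIANGLES**: the `k`-circuits inside `⋃𝒯` number `0` for
`k ≠ 3` — in particular no four- and no five-circuit. -/
theorem ncard_circuits_subset_skew_union_eq_zero (M : Matroid α) [M.Finite] (𝒯 : Finset (Set α))
    (h𝒯 : ∀ C ∈ 𝒯, M.IsCircuit C ∧ C.ncard = 3) (hskew : M.eRk (⋃ C ∈ 𝒯, C) = 2 * 𝒯.card) {k : ℕ}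
    (hk : k ≠ 3) : {C : Set α | M.IsCircuit C ∧ C.ncard = k ∧ C ⊆ ⋃ C' ∈ 𝒯, C'}.ncard = 0 := by
  have hempty : {C : Set α | M.IsCircuit C ∧ C.ncard = k ∧ C ⊆ ⋃ C' ∈ 𝒯, C'} = ∅ := by
    ext C
    simp only [Set.mem_setOf_eq, Set.mem_empty_iff_false, iff_false]
    rintro ⟨hC, hCk, hCsub⟩
    have hmem := mem_of_isCircuit_subset_skew_union M 𝒯 h𝒯 hskew hC hCsub
    exact hk (hCk.symm.trans (h𝒯 C hmem).2)
  rw [hempty, Set.ncard_empty]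

end S1

end PercRepro
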